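import Summits.HodgeConjecture.HodgeConjecture.Theorems.GenericDivisibilityBounded.Negative.LoadBearing
import Summits.HodgeConjecture.HodgeConjecture.Theorems.GenericDivisibilityBounded.Negative.ConiveauZeroWitness
import Summits.HodgeConjecture.HodgeConjecture.Theorems.GenericDivisibilityBounded.Negative.ConclusionTight
import Summits.HodgeConjecture.HodgeConjecture.Theorems.GenericDivisibilityBounded.Negative.ArenaNonempty
import Literature.FieldTheory.AlgClosed.PadicAlgClEquivComplex

/-!
# Disproof of `GenericDivisibilityBounded` (C2, stmt-HodgeConjecture-18467) — findings

Standing disprover's work file. gen-1 = cdisprove cycle 1 (refuter-cdisprove-…-18467-0, 2026-08-17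
06–07Z); gen-2 = cdisprove cycle 1 of the re-armed seat (refuter-cdisprove-…-18467-g2-0, 2026-08-17
13:45Z–), written against PICKED = line `finite-level-bootstrap` (lead c4, ONE open stub: the heart
`stub_finiteLevel`; `stuck_stubs = []`, `targets = []`). **NO KILL of the crux; no stub broken.**
Everything conclusive is LANDED under `Theorems/GenericDivisibilityBounded/Negative/` and only
re-exported here; prose is in doc comments; the two abstract models of §5 are self-contained Lean.

## 0. Status board of the STATEMENT (every syntactic constituent of C2, machine-checked)

C2: `∀ p ≥ 1, ∀ X` smooth projective of dim `2p`, `∀ z ∈ H^{2p}(X(ℂ);ℤ)`,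
`(∀ m ≥ 1, ∃ Z closed, Z ≠ univ, ∃ y, m • y = z|_{(X∖Z)(ℂ)}) → z ⊗ 1 ∈ N¹ = supportedClasses X (2p) 1`.

| constituent | status | certificate |
|---|---|---|
| elaborates, no junk | ✓ rc0; "closed `≠ univ`" = "codim ≥ 1" | `LoadBearing.genericDivisibilityBounded_iff_codimOne` (gen-1) |
| `∀ m` (all moduli) | LOAD-BEARING, **unconditional** (gen-2) | `ConiveauZeroWitness.not_genericDivisibilityBoundedSingleModulus`: every single modulus `m ≥ 1` is FALSE on `E_i × E_i` |
| `Z ≠ univ` | LOAD-BEARING (gen-2) | `ConiveauZeroWitness.genericDivisibilityBounded_false_without_neUniv` (`Z = X`, empty open) |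
| `IsClosed Z` | LOAD-BEARING (gen-2) | `ConiveauZeroWitness.genericDivisibilityBounded_false_without_isClosed` (`Z = X ∖ {η}`: no complex point over `η`) |
| `1 ≤ m` | not load-bearing for truth: `m = 0` allowed STRENGTHENS the hypothesis (`z| = 0`) | remark |
| `1 ≤ p` | not load-bearing: `p = 0` true (`X = Spec ℂ`, `Z = ∅` forced) | gen-1 remark |
| `IsSmoothProjective` (irreducibility inside) | load-bearing on paper (`X₁ ⊔ X₂`), bundled | gen-1 remark |
| conclusion `∈ N¹` vs `= 0` | TIGHT (gen-2): `= 0` is FALSE | `ConclusionTight.genericDivisibilityBounded_false_with_conclusionEqZero` (multiple of a divisor class: hypothesis holds with a FIXED open, `z ⊗ 1 ≠ 0`, yet `∈ N¹`) |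
| hypothesis open FIXED (`∃ Z ∀ m`) | then C2 is TRIVIAL: `z| ∈ ⋂ₘ m·H(U) = tors`, so `z ∈ GT ⇒ z⊗1 ∈ N¹` | the m-DEPENDENCE of `Z_m` (growth of supports) is the whole content |
| decl vs ℓ-adic form | decl is the WEAK (all-primes) form | `LoadBearing.not_primePower_of_not` (gen-1) and §5 below: the single-prime form can fail at EVERY prime while the all-moduli form holds (skeleton level) |
| torsion witnesses (Atiyah–Hirzebruch, Kollár) | inert | `LoadBearing.conclusion_of_torsion`, `hypothesis_of_torsion` (gen-1) |
| arena `N¹ ≠ ⊤` non-empty in Lean | p = 1: `E_τ × E_τ`; **p = 2: `(E_τ×E_τ)²`** (gen-2) | `ConiveauZeroWitness.supportedClasses_square_two_one_ne_top`, `ArenaNonempty.supportedClasses_squareProd_four_one_ne_top`, `exists_fourfold_offSupportedTop`, `existsMiddleClassOfConiveauZero_two` |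

New tree facts that made gen-2 possible (vs gen-1's "not constructible"): the Grothendieck-1969 barrier
is PROVED (`…GeneralizedHodgeTrivialReasonsHolds`, librarian g29 2026-08-16); `WeilSquare.square` =
`E_τ × E_τ` with torus Hodge model (`WeilClassesSurfacesProofs`), `ComplexTorus.cconstClassEquiv`
(invariant forms = de Rham cohomology), Künneth for Hodge types with the PROVED multiplicative de Rham
theorem (`isOfHodgeType_cupProduct_map_fst_map_snd_of_multiplicative_deRham` + `exists_deRhamIsoFamily_holds`).

## 1. Algebraic skeleton (gen-1 §1, kept; inputs Bloch–Ogus + CT–Voisin arXiv:1005.2778 Thm 3.1)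

`H = H^{2p}(X(ℂ);ℤ)`, `GT = {x : ∃ U ≠ ∅, N ≥ 1, N x|_U = 0} = ringChange⁻¹(N¹)` (lead c4 p160596),
`E = H/GT` (f.g. FREE, rank `b_{2p} − dim N¹`), `H_η = H^{2p}(ℂ(X);ℤ) = colim_U H^{2p}(U(ℂ);ℤ)`
(torsion-free by CT–V 3.1; `E ↪ H_η`, lead c4 p160865/p162355).
* **C2 at X ⟺ `E ∩ div(H_η) = 0`** ⟺ no rational `e ∈ E∖0` is divisible by every `m` in `H_η`
  ⟺ (finite level) no primitive `v ∈ E` has `v/m ∈ H^{2p}_nr(X;ℤ)` for all `m`.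
* `p = 1` TRUE (`H²_nr(ℤ)/E = 0`, CT–V §4.1; the line's `genericDivisibilityBounded_one`);
  degree-3 sibling TRUE (`T_ℓ Griff² = 0`, Merkurjev–Suslin); first open case `p = 2`:
  `0 → H⁴_nr/E → H²(X,𝓗³(ℤ)) → N²H⁵ → 0`, so C2(p=2) ⟸ no ALIGNED `ℚ/ℤ` (all primes, one rational
  direction) in `H²(X_Zar,𝓗³(ℤ))`.
* WHERE a counterexample must live (unchanged, now Lean-inhabited): `N¹H^{2p} ≠ H^{2p}` (granted GHC:
  `h^{2p,0} ≠ 0`) — abelian / HK / CY `2p`-folds, `S × S'` with `p_g p_g' > 0`; `z` non-Hodge or a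
  GHC-violator; and (HEART-c2 §F.1) on any `X` satisfying C1 where HC is open in degree `2p`, a C2
  phantom IS a Hodge-conjecture counterexample: C2 is "Hodge-free" in statement only.

## 2. gen-2 sharpening of the HEART's target (`stub_finiteLevel`, one clean prime, `p ≥ 2`)

With `M_ℓ := H_η ⊗ ℤ_ℓ` (torsion-free ℤ_ℓ-module, so `⋂_r ℓ^r M_ℓ = div(M_ℓ)`, a ℚ_ℓ-space):
* **heart(ℓ, X) ⟺ `(E ⊗ ℤ_ℓ) ∩ div(H_η ⊗ ℤ_ℓ) = 0`** ⟺ `E ⊗ ℤ_ℓ → (H_η)^∧_ℓ = lim_r K^M_{2p}(ℂ(X))/ℓ^r`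
  injective ⟺ **the coniveau filtration commutes with the ℓ-adic limit in degree 2p:
  `lim_r N¹H^{2p}(X;ℤ/ℓ^r) = N¹H^{2p}(X;ℤ_ℓ) (= N¹_ℤ ⊗ ℤ_ℓ)`** — i.e. the support divisor `D_r` of
  `N¹(ℤ/ℓ^r)` can be taken INDEPENDENT of `r` (Scavia–Suzuki's ℓ-adic `N^c` (arXiv:2304.08560 §2.1)
  is the right-hand side, with one uniform support by Noetherianity; the heart asks that the
  finite-level filtrations see nothing more). C2 ⟺ the same with `Ẑ` (all primes at once, rational `e`).
* Consequently a disprover's witness against the heart at `(X, ℓ)` is a sequence of divisors `D_r` of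
  UNBOUNDED degree with `e mod ℓ^r` dying off `D_r` for one fixed `e ∈ E ⊗ ℤ_ℓ ∖ 0` — never one bad level
  (level monotonicity, lead c4 p161788), never bounded-degree supports, never torsion of bounded
  exponent (Schreieder's infinite 2-torsion is harmless).

## 3. Line `finite-level-bootstrap` — targets, attacks, verdict (gen-2)

`-- Targets`: none served (`stuck_stubs = []`); the only open stub is the heart. Joint sufficiency is
kernel-checked (`GenericDivisibilityBounded_of : Sig.stub_finiteLevel → C2`, landed p157932), so the
line cannot smuggle a gap; what it CAN do is die with the crux alive (§5: its heart is strictly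
stronger than C2 at the skeleton level, at every prime simultaneously).
Attacks run this cycle on the heart:
(a) hypothesis mutation of the heart's `D'(ℓ^s, z)` — its three guards `1 ≤ M`, `Z ≠ univ`,
    `IsClosed Z` are LOAD-BEARING (landed p166471, `Negative/HeartLoadBearing`): dropping any one
    makes `D'` hold for every `z`, the heart then forces `H = ℓH + GT`, hence `GT = H` by the line's
    own Krull funnel (`genericallyTorsion_of_forall_exists_sub_smul`), hence `N¹ = ⊤` — false on
    `(E_i × E_i)²`. Degenerate parameters: `ℓ = 1` / `s = 0` only weaken the `∃`; `p = 1` is the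
    landed `stub_surfaceLevelOne`; `N¹ = ⊤` is the landed sector (heart ∀(ℓ,s)); nothing to break.
(b) arena — now INHABITED at `p = 2` in Lean (`(E_τ×E_τ)²`, `ArenaNonempty`), so the heart's open part
    (`stub_cruxOfOneCleanPrimeOffSupportedTop`'s hypothesis) is about a constructible `X`; on that `X`
    (`E_i⁴`, CM by `ℤ[i]`) HEART-c2 §D.1 proves the heart at every split `ℓ ≡ 1 (4)` ON PAPER
    (Bloch–Kato/Bloch–Esnault ordinary symbol + complex conjugation swapping the CM eigenlines; I
    re-derived it: `Φ₁ ⊆ T̄` is `ℤ_ℓ[i]`- and `c`-stable and `≠ T̄`, hence `0` — the argument is sound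
    given BE Thm 1.2 at an ordinary prime and `ℓ ∤ [H : N¹ ⊕ T]`), so `E_i⁴` cannot kill the heart
    (`∃ ℓ`); it can at most show PRIME-SENSITIVITY at inert/ramified `ℓ ∈ {2, 3, 7, 11, …}` — open.
(c) the computable shadow of HEART-c4 §D (abelian arrangements `D = ⋃` graphs of `ℓ^r`-isogenies in
    `E⁴`, `ord_ℓ` of the incidence class `t|_D ∈ H⁴(D;ℤ)_tors`): NOT run — design finding: any model
    that is FORMAL on the Čech nerve (E₁-data `Λ^b(Λ_I^∨)` with restriction maps only) returns
    `t|_D = 0` identically, because for a strict diagram of POINTED `K(π,1)`'s the map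
    `H₄(D) → H₄(A)` kills every Čech-positive cell; the torsion (if any) is carried exactly by the
    component groups `G_I = π₀(B_I)` through the twisting 2-cochain of the Grothendieck construction
    (Thomason: `D ≃ B(∫_I Π₁ B_I)`). A sound job must implement that twisted model (or cubulate `T⁸`
    at mesh `ℓ^r`, infeasible); left as a `ccert`/`cscan` specification, not a guess.
(d) literature for a printed (counter)example to "coniveau commutes with the ℓ-adic limit" in degree
    `2p = dim X ≥ 4`: none (§4).
Verdict for the lead: no stub is false; the heart is open exactly off `N¹ = ⊤`, inhabited at `p = 2`
by `E_i⁴` where it holds at split primes on paper; a Lean refutation of the heart would need an `X`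
all of whose primes carry an irrationally-or-rationally placed divisible phantom — no candidate known
(HEART-c2 §F arenas: Weil-type abelian fourfolds, Mumford-type fourfolds).

## 4. Literature read this cycle (gen-2; OpenAlex/S2 rate-limited, zbMATH/Crossref/arXiv/local fine)

* Jannsen 1989 (doi:10.1007/978-1-4613-9649-9_5, held; pp. 1–2, 22–24, 35–38): coranks of
  `H^i(G_S, H^j(X̄,ℚ_ℓ/ℤ_ℓ(n)))`, Question 2 / Thm 4 on localisation maps — NOT the generic coniveau
  question (corrects the pointer in HEART-c2 G.5).
* Voisin 2012 (doi:10.4171/119-1/20, held; Thm 0.2): `0 → H⁴_nr(X,ℤ)⊗ℚ/ℤ → H⁴_nr(X,ℚ/ℤ) → T³(X) → 0`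
  under "`H⁵/N²H⁵` torsion-free" — this is the graded piece `H¹(X,𝓗⁴(ℤ))_tors` (torsion codim-3
  cycles, AJ-trivial, mod alg), NOT our `H²(X,𝓗³(ℤ))`; no divisibility statement.
* Scavia–Suzuki 2023 (arXiv:2304.08560, held; §2.1): ℓ-adic `N^c`, `Ñ^c` defined with ℤ_ℓ-coefficients
  and ONE uniform support; finite levels never compared — the heart is precisely that comparison.
* Benoist–Ottem 2021 (arXiv:2003.02199, held; §7.6): open question on `Ñ^c ⊊ N^c` with `ℤ/p` — the
  strong/ordinary comparison, orthogonal to ours.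
* (gen-1: CT–Voisin 2012 §3–4, Schreieder 2010.05814 / 2011.15047, Bloch–Esnault, Totaro; HEART-c2:
  Rosenschon–Srinivas 2016 Prop 3.1, Jannsen LNM 1400.) Net: the heart / C2 for `2p = dim X ≥ 4` is not
  in print in either direction.

## 5. Contents of this file

* re-exports (one-liners onto the landed Negative lemmas, so their TYPES are visible here):
  `allModuli_loadBearing`, `neUniv_loadBearing`, `isClosed_loadBearing`, `conclusion_tight`,
  `arena_nonempty_one`, `arena_nonempty_two`, `coniveauZero_witness_one`, `coniveauZero_witness_two`;
* remark (b): the FIXED-open variant of C2 is trivially true (content of C2 = growth of `Z_m`);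
* (d) `-- Line finite-level-bootstrap`: index of the heart's load-bearing lemmas landed in
  `Negative/HeartLoadBearing.lean` (p166471; listed with types, not imported — see (d));
* §5 `Skeleton.*` — **skeleton separation** (`Skeleton.skeleton_separation`): a torsion-free pair
  `E ⊆ M ⊂ ℚ²` with `CruxShape` TRUE while `SinglePrimeShape ℓ` and `HeartShape ℓ` FAIL AT EVERY
  PRIME (`M = {x : ∀ q, x ∈ ℤ_(q)² + ℚ(1,q)}`, witness `(1,ℓ)`); so neither the line's heart nor the
  route's ℓ-adic kill criterion follows from C2 by any argument seeing only `(E ⊆ H_η)`;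
  and the finer `Skeleton.skeleton_separation_irrational`: over `ℚ_ℓ²`, `M = ℤ_ℓ² + ℚ_ℓ(1,α)` with
  `α ∈ ℤ_ℓ ∖ ℚ` (exists: `#ℚ_ℓ = 𝔠`) has `SinglePrimeShapeP` TRUE and `HeartShapeP` FALSE — the heart
  can fail at `ℓ` while even `C2_ℓ` holds (STRATEGY-CENSUS' irrational phantom, now machine-checked).
-/

noncomputable section

-- The mandated namespace repeats `HodgeConjecture` (single-conjunct summit).
set_option linter.dupNamespace false

open CategoryTheory AlgebraicGeometry

namespace Summit.HodgeConjecture.HodgeConjecture.Cruxes.GenericDivisibilityBounded.Disproof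

open Literature.AlgebraicGeometry.Motives Literature.AlgebraicGeometry.HodgeTheory
  Literature.AlgebraicTopology.SingularHomology
open Summit.HodgeConjecture.HodgeConjecture.Theses.GenericDivisibility
  (GenericDivisibilityBounded TorsionDiesGenerically)
open Summit.HodgeConjecture.HodgeConjecture.Theorems
open Summit.HodgeConjecture.HodgeConjecture.Theorems.GenericDivisibilityBounded.Negative.LoadBearing
open Summit.HodgeConjecture.HodgeConjecture.Theorems.GenericDivisibilityBounded.Negative.ConiveauZeroWitness
open Summit.HodgeConjecture.HodgeConjecture.Theorems.GenericDivisibilityBounded.Negative.ConclusionTight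
open Summit.HodgeConjecture.HodgeConjecture.Theorems.GenericDivisibilityBounded.Negative.ArenaNonempty

/-! ### (a) Load-bearing hypotheses — all UNCONDITIONAL now (landed p164974) -/

/-- `∀ m` is load-bearing: the one-modulus form is false for every `m ≥ 1` (on `E_i × E_i`). -/
theorem allModuli_loadBearing {m : ℕ} (hm : 1 ≤ m) : ¬ GenericDivisibilityBoundedSingleModulus m :=
  not_genericDivisibilityBoundedSingleModulus hm

/-- `Z ≠ univ` is load-bearing (the empty open makes every class divisible). -/
theorem neUniv_loadBearing :
    ¬ (∀ ⦃p : ℕ⦄ ⦃X : SchemeOver ℂ⦄, 1 ≤ p → IsSmoothProjective (2 * p) X →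
        ∀ z : singularCohomology ℤ ℤ (ComplexPoints X) (2 * p),
          (∀ m : ℕ, 1 ≤ m → ∃ Z : Set X.left, IsClosed Z ∧
            ∃ y : singularCohomology ℤ ℤ (complexPointsCompl X Z) (2 * p),
              m • y = restrictOff X Z (2 * p) z) →
          singularCohomology.ringChange (Int.castRingHom ℂ) (ComplexPoints X) (2 * p) z ∈
            supportedClasses X (2 * p) 1) :=
  genericDivisibilityBounded_false_without_neUniv

/-- `IsClosed Z` is load-bearing (`Z = X ∖ {η}` is `≠ univ` with NO complex point off it). -/
theorem isClosed_loadBearing :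
    ¬ (∀ ⦃p : ℕ⦄ ⦃X : SchemeOver ℂ⦄, 1 ≤ p → IsSmoothProjective (2 * p) X →
        ∀ z : singularCohomology ℤ ℤ (ComplexPoints X) (2 * p),
          (∀ m : ℕ, 1 ≤ m → ∃ Z : Set X.left, Z ≠ Set.univ ∧
            ∃ y : singularCohomology ℤ ℤ (complexPointsCompl X Z) (2 * p),
              m • y = restrictOff X Z (2 * p) z) →
          singularCohomology.ringChange (Int.castRingHom ℂ) (ComplexPoints X) (2 * p) z ∈
            supportedClasses X (2 * p) 1) :=
  genericDivisibilityBounded_false_without_isClosed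

/-- A middle class of coniveau `0` exists at `p = 1` (`E_i × E_i`; discharge of gen-1's `H`) … -/
theorem coniveauZero_witness_one : ExistsMiddleClassOfConiveauZero := existsMiddleClassOfConiveauZero

/-- … and at `p = 2` (`E_i⁴`): the first rung of the heart has a constructible class to be about. -/
theorem coniveauZero_witness_two :
    ∃ (X : SchemeOver ℂ) (z : singularCohomology ℤ ℤ (ComplexPoints X) (2 * 2)),
      IsSmoothProjective (2 * 2) X ∧
        singularCohomology.ringChange (Int.castRingHom ℂ) (ComplexPoints X) (2 * 2) z ∉
          supportedClasses X (2 * 2) 1 :=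
  existsMiddleClassOfConiveauZero_two

/-- The arena of the heart is inhabited: `N¹H² ≠ H²` on `E_τ × E_τ` … -/
theorem arena_nonempty_one (τ : ℂ) (hτ : τ.im ≠ 0) :
    supportedClasses (WeilSquare.square τ hτ).X 2 1 ≠ ⊤ :=
  supportedClasses_square_two_one_ne_top τ hτ

/-- … and `N¹H⁴ ≠ H⁴` on `(E_τ × E_τ)²` — a smooth projective FOURFOLD off every landed sector of line
`finite-level-bootstrap`, i.e. satisfying the hypothesis of `stub_cruxOfOneCleanPrimeOffSupportedTop`. -/
theorem arena_nonempty_two :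
    ∃ X : SchemeOver ℂ, IsSmoothProjective (2 * 2) X ∧ supportedClasses X (2 * 2) 1 ≠ ⊤ :=
  exists_fourfold_offSupportedTop

/-! ### (b) Tightness of the conclusion (landed p165477)

Remark (the FIXED-open variant is trivial, no Lean needed by the lead): if ONE proper closed `Z` serves
every `m`, then `z|_U ∈ ⋂ₘ m • H^{2p}(U(ℂ);ℤ)`, a subgroup of the torsion of that finitely generated
group (Dimca, PROVED: `Dimca1992_finite_singularCohomology_complexPointsCompl_holds`; Krull on the free
quotient), so `N • z|_U = 0` for some `N ≥ 1`, i.e. `z ∈ GT`, and `z ⊗ 1 ∈ N¹` by the line's bridge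
`genericDivisibilityBounded_ringChange_mem_supportedClasses`. Hence the whole content of C2 is the
GROWTH of the exceptional divisors `Z_m` with `m` (§2 of the module docstring). -/

/-- The conclusion `∈ N¹` cannot be improved to `= 0`: a multiple of a divisor class dies on a fixed
non-empty open (so is divisible by every `m` there) and has non-zero complexification. -/
theorem conclusion_tight :
    ¬ (∀ ⦃p : ℕ⦄ ⦃X : SchemeOver ℂ⦄, 1 ≤ p → IsSmoothProjective (2 * p) X →
        ∀ z : singularCohomology ℤ ℤ (ComplexPoints X) (2 * p),
          (∀ m : ℕ, 1 ≤ m → ∃ Z : Set X.left, IsClosed Z ∧ Z ≠ Set.univ ∧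
            ∃ y : singularCohomology ℤ ℤ (complexPointsCompl X Z) (2 * p),
              m • y = restrictOff X Z (2 * p) z) →
          singularCohomology.ringChange (Int.castRingHom ℂ) (ComplexPoints X) (2 * p) z = 0) :=
  genericDivisibilityBounded_false_with_conclusionEqZero

/-- … and the tightness witness satisfies BOTH the hypothesis and the true conclusion of C2. -/
theorem conclusion_tight_witness :
    ∃ (X : SchemeOver ℂ) (_ : IsSmoothProjective (2 * 1) X)
      (z : singularCohomology ℤ ℤ (ComplexPoints X) (2 * 1)),
      (∀ m : ℕ, 1 ≤ m → ∃ Z : Set X.left, IsClosed Z ∧ Z ≠ Set.univ ∧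
        ∃ y : singularCohomology ℤ ℤ (complexPointsCompl X Z) (2 * 1), m • y = restrictOff X Z (2 * 1) z) ∧
      singularCohomology.ringChange (Int.castRingHom ℂ) (ComplexPoints X) (2 * 1) z ≠ 0 ∧
      singularCohomology.ringChange (Int.castRingHom ℂ) (ComplexPoints X) (2 * 1) z ∈
        supportedClasses X (2 * 1) 1 :=
  exists_hypothesis_holds_ringChange_ne_zero

/-! ### (d) `-- Line finite-level-bootstrap` / `-- Targets` (none served): the heart `stub_finiteLevel`

No stub is false. LANDED p166471, `Theorems/GenericDivisibilityBounded/Negative/HeartLoadBearing.lean`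
(namespace `…Theorems.GenericDivisibilityBounded.Negative.HeartLoadBearing`; not imported here only
because the farm snapshot had not rebuilt it at publication time — import it directly):
* `stub_finiteLevel_false_without_oneLeM : ¬ (Sig.stub_finiteLevel with "1 ≤ M" deleted from D')`;
* `stub_finiteLevel_false_without_neUniv : ¬ (Sig.stub_finiteLevel with "Z ≠ Set.univ" deleted from D')`;
* `stub_finiteLevel_false_without_isClosed : ¬ (Sig.stub_finiteLevel with "IsClosed Z" deleted from D')`;
  each mutant makes `D'(ℓ^s, z)` hold for EVERY `z` (`M = 0` / empty open / `Z = X ∖ {η}`), the heart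
  then forces `H = ℓ H + GT`, hence `GT = H` by
* `genericallyTorsion_of_forall_exists_sub_smul (hX) (hℓ : 2 ≤ ℓ) (h : ∀ z, ∃ w, z - ℓ • w ∈ GT) (z) : z ∈ GT`
  (iterate + the line's Krull funnel `genericDivisibilityBounded_genericallyTorsion_of_forall_pow`,
  p150537) and `supportedClasses_eq_top_of_forall_exists_sub_smul : … → supportedClasses X k 1 = ⊤`,
  contradicting `ArenaNonempty.supportedClasses_squareProd_four_one_ne_top` on `(E_i × E_i)²`;
* `pt_ne_genericPoint_of_ne` (two distinct complex points ⇒ none lies over `η`),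
  `exists_ne_complexPoints_squareProd`.
So the three guards of `D'` are load-bearing, and the funnel direction of the heart ("clean ⇒ every
class generically torsion") is exactly as strong as `N¹ = ⊤`. -/

end Summit.HodgeConjecture.HodgeConjecture.Cruxes.GenericDivisibilityBounded.Disproof

/-! ### (c) §5 — The algebraic skeleton of C2 is STRICTLY weaker than the ℓ-adic kill criterion and than the
# line's heart — a two-prime rational model

Every seat (Disproof.lean §1, STRATEGY-CENSUS, HEART-c2 §B) reduces the crux C2 at `X`, its single-prime
form `C2_ℓ` and the heart `stub_finiteLevel` of line `finite-level-bootstrap` to statements about ONE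
pair `E ⊆ M`: `M = H^{2p}(ℂ(X);ℤ)` modulo torsion (torsion-free, huge), `E = H^{2p}(X(ℂ);ℤ)/GT` (a
finitely generated subgroup):
* `CruxShape M E`   : `E ∩ ⋂_{m ≥ 1} m M = 0`;
* `SinglePrimeShape ℓ M E` : `E ∩ ⋂_r ℓ^r M = 0`  (the route's kill criterion is its negation);
* `HeartShape ℓ M E` : `∃ s ≥ 1, E ∩ ℓ^s M ⊆ ℓ E`  (`LevelClean ℓ s`, with `GT` already divided out).
`skeleton_separation`: inside `ℚ²`, `E = ℤ²` and `M = {x : ∀ q prime, x ∈ ℤ_(q)² + ℚ·(1,q)}`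
(`⊇ ℤ[1/ℓ]·(1,ℓ)` for every prime `ℓ`) satisfy `CruxShape` (two primes suffice: `b = 2a = 3a`) while
`SinglePrimeShape ℓ` and `HeartShape ℓ` FAIL AT EVERY PRIME (witness `(1, ℓ)`, infinitely
`ℓ`-divisible in `M`, not in `ℓE`). So no argument that sees only the abstract pair `(E ⊆ M)` derives
`∃ ℓ, HeartShape ℓ` or `∃ ℓ, SinglePrimeShape ℓ` from `CruxShape`: the line's transfer
`C2 ⟸ heart` and the kill criterion `¬C2_ℓ` both need GEOMETRIC input about `H^{2p}(ℂ(X);ℤ)`, and a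
witness against the heart / against `C2_ℓ` at every prime is still not a witness against C2.
(The finer separation `SinglePrimeShape ℓ ∧ ¬HeartShape ℓ` — an irrationally placed phantom line
`ℤ_ℓ·(1,α)`, `α ∈ ℤ_ℓ ∖ ℚ`, STRATEGY-CENSUS §skeleton 3 — needs ℓ-adic irrationals and is not
formalised here.)
-/

namespace Summit.HodgeConjecture.HodgeConjecture.Cruxes.GenericDivisibilityBounded.Disproof.Skeleton

/-! ### Shapes -/

/-- `E ∩ ⋂_{m ≥ 1} m • M = 0`: the skeleton of C2 at `X`. -/
def CruxShape (M E : AddSubgroup (ℚ × ℚ)) : Prop :=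
  ∀ e ∈ E, (∀ m : ℕ, 1 ≤ m → ∃ x ∈ M, e = m • x) → e = 0

/-- `E ∩ ⋂_r ℓ^r • M = 0`: the skeleton of the single-prime crux `C2_ℓ` (negation = kill criterion). -/
def SinglePrimeShape (ℓ : ℕ) (M E : AddSubgroup (ℚ × ℚ)) : Prop :=
  ∀ e ∈ E, (∀ r : ℕ, ∃ x ∈ M, e = ℓ ^ r • x) → e = 0

/-- `∃ s ≥ 1, E ∩ ℓ^s • M ⊆ ℓ • E`: the skeleton of the heart `∃ s, LevelClean ℓ s` (after `/GT`). -/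
def HeartShape (ℓ : ℕ) (M E : AddSubgroup (ℚ × ℚ)) : Prop :=
  ∃ s : ℕ, 1 ≤ s ∧ ∀ e ∈ E, (∃ x ∈ M, e = ℓ ^ s • x) → ∃ e' ∈ E, e = ℓ • e'

/-! ### `q`-integral rationals -/

/-- `y ∈ ℤ_(q)`: `y = n / d` with `d` prime to `q`. -/
def IsIntAt (q : ℕ) (y : ℚ) : Prop := ∃ (n : ℤ) (d : ℕ), q.Coprime d ∧ d ≠ 0 ∧ y = n / d

theorem IsIntAt.intCast (q : ℕ) (n : ℤ) : IsIntAt q n := ⟨n, 1, Nat.coprime_one_right q, one_ne_zero, by simp⟩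

theorem IsIntAt.zero (q : ℕ) : IsIntAt q 0 := by simpa using IsIntAt.intCast q 0

theorem IsIntAt.add {q : ℕ} {y y' : ℚ} (h : IsIntAt q y) (h' : IsIntAt q y') : IsIntAt q (y + y') := by
  obtain ⟨n, d, hd, hd0, rfl⟩ := h
  obtain ⟨n', d', hd', hd0', rfl⟩ := h'
  refine ⟨n * d' + n' * d, d * d', Nat.Coprime.mul_right hd hd', mul_ne_zero hd0 hd0', ?_⟩
  have : (d : ℚ) ≠ 0 := by exact_mod_cast hd0
  have : (d' : ℚ) ≠ 0 := by exact_mod_cast hd0'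
  push_cast
  field_simp

theorem IsIntAt.neg {q : ℕ} {y : ℚ} (h : IsIntAt q y) : IsIntAt q (-y) := by
  obtain ⟨n, d, hd, hd0, rfl⟩ := h
  exact ⟨-n, d, hd, hd0, by push_cast; ring⟩

theorem IsIntAt.sub {q : ℕ} {y y' : ℚ} (h : IsIntAt q y) (h' : IsIntAt q y') : IsIntAt q (y - y') := by
  simpa [sub_eq_add_neg] using h.add h'.neg

theorem IsIntAt.mul_intCast {q : ℕ} {y : ℚ} (h : IsIntAt q y) (k : ℤ) : IsIntAt q (y * k) := by
  obtain ⟨n, d, hd, hd0, rfl⟩ := h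
  exact ⟨n * k, d, hd, hd0, by push_cast; ring⟩

/-- `1 / ℓ^r ∈ ℤ_(q)` for distinct primes `q ≠ ℓ`. -/
theorem IsIntAt.one_div_pow {q ℓ : ℕ} (hq : q.Prime) (hℓ : ℓ.Prime) (hne : q ≠ ℓ) (r : ℕ) :
    IsIntAt q (1 / (ℓ : ℚ) ^ r) :=
  ⟨1, ℓ ^ r, Nat.Coprime.pow_right r ((Nat.coprime_primes hq hℓ).2 hne),
    pow_ne_zero r hℓ.ne_zero, by push_cast; ring⟩

/-- An integer divided by `ℓ^k` is `ℓ`-integral only if `ℓ^k` divides it. -/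
theorem pow_dvd_of_isIntAt {ℓ : ℕ} (hℓ : ℓ.Prime) {z : ℤ} {k : ℕ}
    (h : IsIntAt ℓ ((z : ℚ) / (ℓ : ℚ) ^ k)) : ((ℓ : ℤ) ^ k) ∣ z := by
  obtain ⟨n, d, hd, hd0, hnd⟩ := h
  have hℓ0 : ((ℓ : ℚ) ^ k) ≠ 0 := pow_ne_zero k (by exact_mod_cast hℓ.ne_zero)
  have hdq : (d : ℚ) ≠ 0 := by exact_mod_cast hd0
  have key : (z : ℚ) * d = n * (ℓ : ℚ) ^ k := by
    field_simp at hnd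
    linarith [hnd]
  have keyZ : z * (d : ℤ) = n * (ℓ : ℤ) ^ k := by exact_mod_cast key
  have hcop : IsCoprime ((ℓ : ℤ) ^ k) (d : ℤ) := by
    rw [Int.isCoprime_iff_gcd_eq_one]
    have : Nat.Coprime (ℓ ^ k) d := Nat.Coprime.pow_left k hd
    simpa [Int.gcd, Int.natAbs_pow] using this
  exact hcop.dvd_of_dvd_mul_right ⟨n, by rw [keyZ]; ring⟩

/-- An integer divisible by every power of a prime is zero. -/
theorem eq_zero_of_forall_pow_dvd {ℓ : ℕ} (hℓ : ℓ.Prime) {z : ℤ} (h : ∀ k : ℕ, ((ℓ : ℤ) ^ k) ∣ z) :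
    z = 0 := by
  by_contra hz
  have hlt : z.natAbs < ℓ ^ z.natAbs := Nat.lt_pow_self hℓ.one_lt
  have hdvd : ℓ ^ z.natAbs ∣ z.natAbs := by
    have := h z.natAbs
    rwa [← Int.natCast_pow, Int.natCast_dvd] at this
  exact absurd (Nat.le_of_dvd (Int.natAbs_pos.2 hz) hdvd) (not_le.2 hlt)

/-! ### The model -/

/-- `M_q = ℤ_(q)² + ℚ·(1, q)` (as a subgroup of `ℚ²`). -/
def Mq (q : ℕ) : AddSubgroup (ℚ × ℚ) where
  carrier := {x | ∃ c : ℚ, IsIntAt q (x.1 - c) ∧ IsIntAt q (x.2 - c * q)}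
  zero_mem' := ⟨0, by simpa using IsIntAt.zero q, by simpa using IsIntAt.zero q⟩
  add_mem' := by
    rintro x y ⟨c, hc1, hc2⟩ ⟨c', hc1', hc2'⟩
    refine ⟨c + c', ?_, ?_⟩
    · have := hc1.add hc1'; convert this using 1; simp only [Prod.fst_add]; ring
    · have := hc2.add hc2'; convert this using 1; simp only [Prod.snd_add]; ring
  neg_mem' := by
    rintro x ⟨c, hc1, hc2⟩
    refine ⟨-c, ?_, ?_⟩
    · have := hc1.neg; convert this using 1; simp only [Prod.fst_neg]; ring
    · have := hc2.neg; convert this using 1; simp only [Prod.snd_neg]; ring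

/-- `M = ⋂_{q prime} M_q`: the "generic classes" of the model. -/
def M : AddSubgroup (ℚ × ℚ) where
  carrier := {x | ∀ q : ℕ, q.Prime → x ∈ Mq q}
  zero_mem' := fun q _ ↦ (Mq q).zero_mem
  add_mem' := fun hx hy q hq ↦ (Mq q).add_mem (hx q hq) (hy q hq)
  neg_mem' := fun hx q hq ↦ (Mq q).neg_mem (hx q hq)

/-- `E = ℤ² ⊂ ℚ²`: the lattice of the model (`H^{2p}(X;ℤ)/GT`). -/
def E : AddSubgroup (ℚ × ℚ) where
  carrier := {x | ∃ a b : ℤ, x = ((a : ℚ), (b : ℚ))}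
  zero_mem' := ⟨0, 0, by ext <;> simp⟩
  add_mem' := by
    rintro x y ⟨a, b, rfl⟩ ⟨a', b', rfl⟩
    exact ⟨a + a', b + b', by push_cast; rfl⟩
  neg_mem' := by
    rintro x ⟨a, b, rfl⟩
    exact ⟨-a, -b, by push_cast; rfl⟩

theorem E_le_M : E ≤ M := by
  rintro x ⟨a, b, rfl⟩ q _
  exact ⟨0, by simpa using IsIntAt.intCast q a, by simpa using IsIntAt.intCast q b⟩

theorem E_fg : E.FG := by
  refine ⟨{((1 : ℚ), (0 : ℚ)), ((0 : ℚ), (1 : ℚ))}, le_antisymm ?_ ?_⟩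
  · rw [AddSubgroup.closure_le]
    rintro x hx
    simp only [Finset.coe_insert, Finset.coe_singleton, Set.mem_insert_iff, Set.mem_singleton_iff] at hx
    rcases hx with rfl | rfl
    · exact ⟨1, 0, by simp⟩
    · exact ⟨0, 1, by simp⟩
  · rintro x ⟨a, b, rfl⟩
    have h1 : ((1 : ℚ), (0 : ℚ)) ∈ AddSubgroup.closure
        ({((1 : ℚ), (0 : ℚ)), ((0 : ℚ), (1 : ℚ))} : Finset (ℚ × ℚ)) :=
      AddSubgroup.subset_closure (by simp)
    have h2 : ((0 : ℚ), (1 : ℚ)) ∈ AddSubgroup.closure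
        ({((1 : ℚ), (0 : ℚ)), ((0 : ℚ), (1 : ℚ))} : Finset (ℚ × ℚ)) :=
      AddSubgroup.subset_closure (by simp)
    have : ((a : ℚ), (b : ℚ)) = a • ((1 : ℚ), (0 : ℚ)) + b • ((0 : ℚ), (1 : ℚ)) := by
      ext <;> simp
    rw [this]
    exact AddSubgroup.add_mem _ (AddSubgroup.zsmul_mem _ h1 a) (AddSubgroup.zsmul_mem _ h2 b)

/-- The infinitely `ℓ`-divisible vectors `(1, ℓ)/ℓ^r` lie in `M`. -/
theorem div_pow_mem_M {ℓ : ℕ} (hℓ : ℓ.Prime) (r : ℕ) :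
    ((1 : ℚ) / (ℓ : ℚ) ^ r, (ℓ : ℚ) / (ℓ : ℚ) ^ r) ∈ M := by
  intro q hq
  by_cases hql : q = ℓ
  · subst hql
    refine ⟨1 / (q : ℚ) ^ r, by simpa using IsIntAt.zero q, ?_⟩
    have : (q : ℚ) / (q : ℚ) ^ r - 1 / (q : ℚ) ^ r * q = 0 := by ring
    rw [this]; exact IsIntAt.zero q
  · refine ⟨0, ?_, ?_⟩
    · simpa using IsIntAt.one_div_pow hq hℓ hql r
    · have h := (IsIntAt.one_div_pow hq hℓ hql r).mul_intCast (ℓ : ℤ)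
      convert h using 1
      push_cast; ring

/-- From `x ∈ M_ℓ`, the combination `x.2 - ℓ x.1` is `ℓ`-integral. -/
theorem isIntAt_snd_sub_of_mem_Mq {ℓ : ℕ} {x : ℚ × ℚ} (hx : x ∈ Mq ℓ) :
    IsIntAt ℓ (x.2 - (ℓ : ℚ) * x.1) := by
  obtain ⟨c, hc1, hc2⟩ := hx
  have h := hc2.sub (hc1.mul_intCast (ℓ : ℤ))
  convert h using 1
  push_cast; ring

/-- **`CruxShape` holds in the model** (even using only the moduli `2^k`, `3^k`). -/
theorem cruxShape_M_E : CruxShape M E := by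
  rintro e ⟨a, b, rfl⟩ h
  -- for a prime `ℓ`, divisibility by all `ℓ^k` forces `b = ℓ a`
  have key : ∀ ℓ : ℕ, ℓ.Prime → b = ℓ * a := by
    intro ℓ hℓ
    have hdvd : ∀ k : ℕ, ((ℓ : ℤ) ^ k) ∣ (b - ℓ * a) := by
      intro k
      obtain ⟨x, hxM, hx⟩ := h (ℓ ^ k) (Nat.one_le_pow k ℓ hℓ.pos)
      have hint := isIntAt_snd_sub_of_mem_Mq (hxM ℓ hℓ)
      have h1 : (a : ℚ) = (ℓ : ℚ) ^ k * x.1 := by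
        have := congrArg Prod.fst hx; simpa [Prod.smul_fst, nsmul_eq_mul] using this
      have h2 : (b : ℚ) = (ℓ : ℚ) ^ k * x.2 := by
        have := congrArg Prod.snd hx; simpa [Prod.smul_snd, nsmul_eq_mul] using this
      have hℓ0 : ((ℓ : ℚ) ^ k) ≠ 0 := pow_ne_zero k (by exact_mod_cast hℓ.ne_zero)
      apply pow_dvd_of_isIntAt hℓ
      convert hint using 1
      rw [div_eq_iff hℓ0]
      push_cast
      rw [h1, h2]; ring
    have := eq_zero_of_forall_pow_dvd hℓ hdvd
    linarith
  have h2 := key 2 Nat.prime_two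
  have h3 := key 3 Nat.prime_three
  have ha : a = 0 := by push_cast at h2 h3; linarith
  have hb : b = 0 := by rw [h2, ha]; simp
  simp [ha, hb]

/-- **`SinglePrimeShape ℓ` FAILS in the model at every prime** (witness `(1, ℓ)`). -/
theorem not_singlePrimeShape_M_E {ℓ : ℕ} (hℓ : ℓ.Prime) : ¬ SinglePrimeShape ℓ M E := by
  intro h
  have hmem : (((1 : ℤ) : ℚ), ((ℓ : ℤ) : ℚ)) ∈ E := ⟨1, ℓ, rfl⟩
  have h0 := h _ hmem fun r ↦ ⟨_, div_pow_mem_M hℓ r, by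
    have hℓ0 : ((ℓ : ℚ) ^ r) ≠ 0 := pow_ne_zero r (by exact_mod_cast hℓ.ne_zero)
    ext <;> simp [nsmul_eq_mul] <;> field_simp⟩
  have := congrArg Prod.fst h0
  simp at this

/-- **`HeartShape ℓ` FAILS in the model at every prime** (same witness, every level `s`). -/
theorem not_heartShape_M_E {ℓ : ℕ} (hℓ : ℓ.Prime) : ¬ HeartShape ℓ M E := by
  rintro ⟨s, -, h⟩
  have hmem : (((1 : ℤ) : ℚ), ((ℓ : ℤ) : ℚ)) ∈ E := ⟨1, ℓ, rfl⟩
  obtain ⟨e', ⟨a, b, rfl⟩, he⟩ := h _ hmem ⟨_, div_pow_mem_M hℓ s, by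
    have hℓ0 : ((ℓ : ℚ) ^ s) ≠ 0 := pow_ne_zero s (by exact_mod_cast hℓ.ne_zero)
    ext <;> simp [nsmul_eq_mul] <;> field_simp⟩
  have h1 : ((1 : ℤ) : ℚ) = (ℓ : ℚ) * a := by
    have := congrArg Prod.fst he; simpa [Prod.smul_fst, nsmul_eq_mul] using this
  have h1Z : (1 : ℤ) = ℓ * a := by exact_mod_cast h1
  have hdvd : (ℓ : ℤ) ∣ 1 := ⟨a, h1Z⟩
  have : (ℓ : ℤ).natAbs = 1 := Int.eq_one_of_dvd_one (by positivity) hdvd |>.symm ▸ rfl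
  simp at this
  exact hℓ.one_lt.ne' this

/-- **Skeleton separation.** There is a torsion-free pair `E ⊆ M` (`E` finitely generated) with the
C2-skeleton TRUE and, at EVERY prime, both the single-prime skeleton and the heart skeleton FALSE. -/
theorem skeleton_separation :
    ∃ M E : AddSubgroup (ℚ × ℚ), E ≤ M ∧ E.FG ∧ CruxShape M E ∧
      ∀ ℓ : ℕ, ℓ.Prime → ¬ SinglePrimeShape ℓ M E ∧ ¬ HeartShape ℓ M E :=
  ⟨M, E, E_le_M, E_fg, cruxShape_M_E, fun _ hℓ ↦ ⟨not_singlePrimeShape_M_E hℓ, not_heartShape_M_E hℓ⟩⟩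

end Summit.HodgeConjecture.HodgeConjecture.Cruxes.GenericDivisibilityBounded.Disproof.Skeleton

/-! ### (c') §5 — Skeleton separation, finer form: the single-prime crux can HOLD while the heart FAILS
# (an irrationally placed phantom line `ℤ_ℓ² + ℚ_ℓ·(1, α)`, `α ∈ ℤ_ℓ ∖ ℚ`)

STRATEGY-CENSUS (§skeleton 3) and the line card state on paper: "`C2_ℓ ⇏ S⁺(ℓ)` (phantom module
`ℤ_ℓ·(1,α)`, `α ∉ ℚ`, irrationally placed)". Machine-checked here over `ℚ_ℓ²`:
`E = ℤ²`, `M = ℤ_ℓ² + ℚ_ℓ·(1, α)` with `α` an IRRATIONAL `ℓ`-adic integer (exists: `#ℚ_ℓ = 𝔠 > ℵ₀`,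
the tree's `Cardinal.mk_padic`). Then `SinglePrimeShapeP` HOLDS (`E ∩ ⋂_r ℓ^r M = E ∩ ℚ_ℓ(1,α) = 0`
because `b = α a` forces `a = b = 0`) while `HeartShapeP` FAILS at every level `s` (witness
`(1, a_s)`, `a_s ≡ α (mod ℓ^s)` an integer: `(1,a_s)/ℓ^s ∈ M`, but `(1, a_s) ∉ ℓ E`).
So the line `finite-level-bootstrap` can die at a prime `ℓ` (unbounded loss) while even the ℓ-adic
kill criterion of the route does NOT fire there: a refutation of the heart is not a refutation of
`C2_ℓ`, let alone of C2.
-/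

namespace Summit.HodgeConjecture.HodgeConjecture.Cruxes.GenericDivisibilityBounded.Disproof.Skeleton

open Cardinal in
/-- **Some `ℓ`-adic integer is irrational** (`#ℚ_ℓ = 𝔠 > ℵ₀ = #ℚ`, then scale into `ℤ_ℓ`). -/
theorem exists_padicInt_irrational (ℓ : ℕ) [Fact ℓ.Prime] :
    ∃ α : ℤ_[ℓ], ∀ q : ℚ, (q : ℚ_[ℓ]) ≠ (α : ℚ_[ℓ]) := by
  have hℓ1 : 1 < (ℓ : ℝ) := by exact_mod_cast (Fact.out : ℓ.Prime).one_lt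
  -- some `β : ℚ_ℓ` is not rational
  obtain ⟨β, hβ⟩ : ∃ β : ℚ_[ℓ], ∀ q : ℚ, (q : ℚ_[ℓ]) ≠ β := by
    by_contra h
    push Not at h
    have hle : #ℚ_[ℓ] ≤ #ℚ := mk_le_of_surjective fun β ↦ h β
    rw [Cardinal.mk_padic, Cardinal.mkRat] at hle
    exact Cardinal.aleph0_lt_continuum.not_ge hle
  -- scale it into the unit ball
  obtain ⟨k, hk⟩ : ∃ k : ℕ, ‖β‖ < (ℓ : ℝ) ^ k := pow_unbounded_of_one_lt ‖β‖ hℓ1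
  have hnorm : ‖(ℓ : ℚ_[ℓ]) ^ k * β‖ ≤ 1 := by
    rw [norm_mul, norm_pow, Padic.norm_p]
    rw [inv_pow, ← div_eq_inv_mul, div_le_one (pow_pos (by linarith) k)]
    exact hk.le
  refine ⟨⟨(ℓ : ℚ_[ℓ]) ^ k * β, hnorm⟩, fun q hq ↦ hβ (q / (ℓ : ℚ) ^ k) ?_⟩
  have hℓ0 : ((ℓ : ℚ_[ℓ]) ^ k) ≠ 0 := pow_ne_zero k (by exact_mod_cast (Fact.out : ℓ.Prime).ne_zero)
  change (q : ℚ_[ℓ]) = (ℓ : ℚ_[ℓ]) ^ k * β at hq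
  push_cast
  rw [hq]
  field_simp

variable {ℓ : ℕ} [Fact ℓ.Prime]

/-- `E ∩ ⋂_r ℓ^r • M = 0` over `ℚ_ℓ²`: the skeleton of the single-prime crux `C2_ℓ`. -/
def SinglePrimeShapeP (M E : AddSubgroup (ℚ_[ℓ] × ℚ_[ℓ])) : Prop :=
  ∀ e ∈ E, (∀ r : ℕ, ∃ x ∈ M, e = (ℓ ^ r) • x) → e = 0

/-- `∃ s ≥ 1, E ∩ ℓ^s • M ⊆ ℓ • E` over `ℚ_ℓ²`: the skeleton of the heart at `ℓ`. -/
def HeartShapeP (M E : AddSubgroup (ℚ_[ℓ] × ℚ_[ℓ])) : Prop :=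
  ∃ s : ℕ, 1 ≤ s ∧ ∀ e ∈ E, (∃ x ∈ M, e = (ℓ ^ s) • x) → ∃ e' ∈ E, e = ℓ • e'

/-- `E = ℤ² ⊂ ℚ_ℓ²`. -/
def EP : AddSubgroup (ℚ_[ℓ] × ℚ_[ℓ]) where
  carrier := {x | ∃ a b : ℤ, x = ((a : ℚ_[ℓ]), (b : ℚ_[ℓ]))}
  zero_mem' := ⟨0, 0, by ext <;> simp⟩
  add_mem' := by
    rintro x y ⟨a, b, rfl⟩ ⟨a', b', rfl⟩
    exact ⟨a + a', b + b', by push_cast; rfl⟩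
  neg_mem' := by
    rintro x ⟨a, b, rfl⟩
    exact ⟨-a, -b, by push_cast; rfl⟩

/-- `M = ℤ_ℓ² + ℚ_ℓ · (1, α)`: a phantom LINE in the direction `(1, α)`. -/
def MP (α : ℤ_[ℓ]) : AddSubgroup (ℚ_[ℓ] × ℚ_[ℓ]) where
  carrier := {x | ∃ (u v : ℤ_[ℓ]) (c : ℚ_[ℓ]), x = ((u : ℚ_[ℓ]) + c, (v : ℚ_[ℓ]) + c * α)}
  zero_mem' := ⟨0, 0, 0, by ext <;> simp⟩
  add_mem' := by
    rintro x y ⟨u, v, c, rfl⟩ ⟨u', v', c', rfl⟩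
    refine ⟨u + u', v + v', c + c', ?_⟩
    ext
    · simp only [Prod.fst_add]; push_cast; ring
    · simp only [Prod.snd_add]; push_cast; ring
  neg_mem' := by
    rintro x ⟨u, v, c, rfl⟩
    refine ⟨-u, -v, -c, ?_⟩
    ext
    · simp only [Prod.fst_neg]; push_cast; ring
    · simp only [Prod.snd_neg]; push_cast; ring

theorem EP_le_MP (α : ℤ_[ℓ]) : (EP : AddSubgroup (ℚ_[ℓ] × ℚ_[ℓ])) ≤ MP α := by
  rintro x ⟨a, b, rfl⟩
  refine ⟨a, b, 0, ?_⟩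
  ext
  · change (a : ℚ_[ℓ]) = ((a : ℤ_[ℓ]) : ℚ_[ℓ]) + 0; push_cast; ring
  · change (b : ℚ_[ℓ]) = ((b : ℤ_[ℓ]) : ℚ_[ℓ]) + 0 * (α : ℚ_[ℓ]); push_cast; ring

/-- For `x ∈ M`, the "defect" `x.2 - α x.1` is an `ℓ`-adic integer. -/
theorem exists_snd_sub_mul_fst {α : ℤ_[ℓ]} {x : ℚ_[ℓ] × ℚ_[ℓ]} (hx : x ∈ MP α) :
    ∃ t : ℤ_[ℓ], x.2 - (α : ℚ_[ℓ]) * x.1 = t := by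
  obtain ⟨u, v, c, rfl⟩ := hx
  exact ⟨v - α * u, by push_cast; ring⟩

/-- An element of `ℚ_ℓ` lying in `ℓ^r ℤ_ℓ` for every `r` is `0`. -/
theorem eq_zero_of_forall_mem_pow {y : ℚ_[ℓ]} (h : ∀ r : ℕ, ∃ t : ℤ_[ℓ], y = (ℓ : ℚ_[ℓ]) ^ r * t) :
    y = 0 := by
  have hℓ1 : 1 < (ℓ : ℝ) := by exact_mod_cast (Fact.out : ℓ.Prime).one_lt
  by_contra hy
  have hpos : 0 < ‖y‖ := norm_pos_iff.2 hy
  -- `‖y‖ ≤ ℓ^{-r}` for every `r`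
  have hle : ∀ r : ℕ, ‖y‖ ≤ ((ℓ : ℝ) ^ r)⁻¹ := by
    intro r
    obtain ⟨t, ht⟩ := h r
    rw [ht, norm_mul, norm_pow, Padic.norm_p, inv_pow]
    exact mul_le_of_le_one_right (by positivity) (PadicInt.norm_le_one t)
  obtain ⟨r, hr⟩ : ∃ r : ℕ, ‖y‖⁻¹ < (ℓ : ℝ) ^ r := pow_unbounded_of_one_lt _ hℓ1
  have h1 := hle r
  rw [le_inv_comm₀ hpos (pow_pos (by linarith) r)] at h1
  exact absurd (lt_of_lt_of_le hr h1) (lt_irrefl _)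

/-- **`SinglePrimeShapeP` HOLDS for the phantom line in an IRRATIONAL direction.** -/
theorem singlePrimeShapeP_MP_EP {α : ℤ_[ℓ]} (hα : ∀ q : ℚ, (q : ℚ_[ℓ]) ≠ (α : ℚ_[ℓ])) :
    SinglePrimeShapeP (MP α) EP := by
  rintro e ⟨a, b, rfl⟩ h
  -- `b - α a ∈ ℓ^r ℤ_ℓ` for all `r`, hence `b = α a`
  have key : (b : ℚ_[ℓ]) - (α : ℚ_[ℓ]) * a = 0 := by
    refine eq_zero_of_forall_mem_pow fun r ↦ ?_
    obtain ⟨x, hxM, hx⟩ := h r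
    obtain ⟨t, ht⟩ := exists_snd_sub_mul_fst hxM
    have h1 : (a : ℚ_[ℓ]) = (ℓ : ℚ_[ℓ]) ^ r * x.1 := by
      have := congrArg Prod.fst hx; simpa [nsmul_eq_mul] using this
    have h2 : (b : ℚ_[ℓ]) = (ℓ : ℚ_[ℓ]) ^ r * x.2 := by
      have := congrArg Prod.snd hx; simpa [nsmul_eq_mul] using this
    exact ⟨t, by rw [h1, h2, ← ht]; ring⟩
  -- if `a ≠ 0`, `α = b / a` would be rational
  by_cases ha : a = 0
  · subst ha
    have hb : (b : ℚ_[ℓ]) = 0 := by simpa using key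
    have hb' : b = 0 := by exact_mod_cast hb
    subst hb'
    ext <;> simp
  · exfalso
    have ha' : (a : ℚ_[ℓ]) ≠ 0 := by exact_mod_cast ha
    refine hα ((b : ℚ) / a) ?_
    push_cast
    rw [div_eq_iff ha']
    linear_combination key

/-- **`HeartShapeP` FAILS for the phantom line (any `α ∈ ℤ_ℓ`)**: at level `s`, the integer vector
`(1, a_s)` with `a_s ≡ α (mod ℓ^s)` is `ℓ^s`-divisible in `M` but not `ℓ`-divisible in `E`. -/
theorem not_heartShapeP_MP_EP (α : ℤ_[ℓ]) : ¬ HeartShapeP (MP α) EP := by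
  have hprime : ℓ.Prime := Fact.out
  rintro ⟨s, -, h⟩
  -- `α = a_s + ℓ^s t`
  obtain ⟨t, ht⟩ : ∃ t : ℤ_[ℓ], α - (PadicInt.appr α s : ℤ_[ℓ]) = t * (ℓ : ℤ_[ℓ]) ^ s :=
    Ideal.mem_span_singleton'.1 (PadicInt.appr_spec s α) |>.imp fun t ht ↦ ht.symm
  set n : ℕ := PadicInt.appr α s with hn
  have hmem : (((1 : ℤ) : ℚ_[ℓ]), ((n : ℤ) : ℚ_[ℓ])) ∈ (EP : AddSubgroup (ℚ_[ℓ] × ℚ_[ℓ])) := ⟨1, n, rfl⟩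
  have hℓ0 : ((ℓ : ℚ_[ℓ]) ^ s) ≠ 0 := pow_ne_zero s (by exact_mod_cast hprime.ne_zero)
  have htQ : (α : ℚ_[ℓ]) - (n : ℚ_[ℓ]) = (t : ℚ_[ℓ]) * (ℓ : ℚ_[ℓ]) ^ s := by
    have := congrArg (fun z : ℤ_[ℓ] ↦ (z : ℚ_[ℓ])) ht
    push_cast at this
    exact this
  -- the `ℓ^s`-th "root" of `(1, a_s)` in `M`
  have hdiv : ∃ x ∈ MP α, (((1 : ℤ) : ℚ_[ℓ]), ((n : ℤ) : ℚ_[ℓ])) = (ℓ ^ s) • x := by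
    refine ⟨(((0 : ℤ_[ℓ]) : ℚ_[ℓ]) + ((ℓ : ℚ_[ℓ]) ^ s)⁻¹,
      ((-t : ℤ_[ℓ]) : ℚ_[ℓ]) + ((ℓ : ℚ_[ℓ]) ^ s)⁻¹ * α), ⟨0, -t, ((ℓ : ℚ_[ℓ]) ^ s)⁻¹, rfl⟩, ?_⟩
    ext
    · change ((1 : ℤ) : ℚ_[ℓ]) = (ℓ ^ s) • (((0 : ℤ_[ℓ]) : ℚ_[ℓ]) + ((ℓ : ℚ_[ℓ]) ^ s)⁻¹)
      rw [nsmul_eq_mul]; push_cast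
      rw [zero_add, mul_inv_cancel₀ hℓ0]
    · change ((n : ℤ) : ℚ_[ℓ]) = (ℓ ^ s) • (((-t : ℤ_[ℓ]) : ℚ_[ℓ]) + ((ℓ : ℚ_[ℓ]) ^ s)⁻¹ * α)
      rw [nsmul_eq_mul]; push_cast
      rw [mul_add, ← mul_assoc, mul_inv_cancel₀ hℓ0, one_mul]
      linear_combination -htQ
  obtain ⟨e', ⟨a', b', rfl⟩, he⟩ := h _ hmem hdiv
  have h1 : ((1 : ℤ) : ℚ_[ℓ]) = (ℓ : ℚ_[ℓ]) * a' := by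
    have := congrArg Prod.fst he; simpa [nsmul_eq_mul] using this
  have h1Z : (1 : ℤ) = ℓ * a' := by exact_mod_cast h1
  have hdvd : (ℓ : ℤ) ∣ 1 := ⟨a', h1Z⟩
  have hℓ1 : ℓ = 1 := by exact_mod_cast Int.eq_one_of_dvd_one (by positivity) hdvd
  exact hprime.one_lt.ne' hℓ1

/-- **Finer skeleton separation**: for every prime `ℓ` there is a torsion-free pair `E ⊆ M` over `ℚ_ℓ`
with the single-prime crux shape TRUE and the heart shape FALSE — the line's heart is strictly stronger
than `C2_ℓ` itself, not only than C2. -/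
theorem skeleton_separation_irrational (ℓ : ℕ) [Fact ℓ.Prime] :
    ∃ M E : AddSubgroup (ℚ_[ℓ] × ℚ_[ℓ]), E ≤ M ∧ SinglePrimeShapeP M E ∧ ¬ HeartShapeP M E := by
  obtain ⟨α, hα⟩ := exists_padicInt_irrational ℓ
  exact ⟨MP α, EP, EP_le_MP α, singlePrimeShapeP_MP_EP hα, not_heartShapeP_MP_EP α⟩

end Summit.HodgeConjecture.HodgeConjecture.Cruxes.GenericDivisibilityBounded.Disproof.Skeleton

end
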